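import Mathlib
import HarnessLib
import HarnessLib.Audit
import Summits.CriticalPhenomena.PercolationContinuityZ3.Theorems.PercNearOneGluingNoHeavyLowerTailHexMSMatchAxisInsert

/-!
# Conjecture (MATCH), two dead classes: Hall for `cl(F ∪ {q})` whenever `F` is Marica–Schönheim-tight (hp-7 gen 70)

Support file for crux `stmt-CriticalPhenomena-4575` (route `PercNearOneGluingNoHeavy`), hull-port seat `prim-hp-7` (generation 70);
`--supports stmt-CriticalPhenomena-4575`.  No `sorry`, no definition.  Memo: `run/shared/lean/prim/prim-hp-7/FROM-prim-hp-7-g70-MS-EQUALITY.md` §2.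

Gen 69 proved Hall's condition for `cl F` when the two-class dead family `F` (labels in `{ℓ, ℓ+1}`) is itself MS-tight (modulo the MS-equality
structure, discharged in `…HexMSMSEquality`).  Here: **Hall's condition `#A ≤ #N(A)` for `A = cl(F ∪ {q})` whenever `F` is MS-tight and `q ∉ F`
is any further dead member of either label** — `F ∪ {q}` need not be tight.

* `sdiff_mem_candidates_of_notMem`, `cl_diffs_subset_biUnion_candidates_of_tight` — for MS-tight two-class `F` every element of `ΔF ∪ co ΔF` is a
  candidate of `cl F` (no blockers, gen 69's `not_blocked_of_twistedProduct` applied to the twisted-product structure over the pivot);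
* `two_mul_card_add_two_le_card_biUnion_candidates_of_tight_insert`, `card_le_card_biUnion_candidates_of_tight_insert` (`x q = ℓ + 1`) and
  `card_le_card_biUnion_candidates_of_tight_insert'` (`x q = ℓ`, by the reflection `x ↦ -x`): the `2 #F` candidates `ΔF ∪ co ΔF` plus the new
  complementary pair of part I (`exists_candidate_notMem_cl_diffs`).
-/

namespace Summit.CriticalPhenomena.PercolationContinuityZ3.Theorems

namespace GeneratedDonors

open Finset FinsetFamily

variable {α : Type*} [DecidableEq α]

section TightInsert

/-! ### Two dead classes: Hall for `cl(F' ∪ {q})` whenever `F'` is MS-tight -/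

variable {U : Finset α} {𝒟 : Finset (Finset α)} {x : Finset α → ZMod 6}

/-- If `f, g ∈ 𝒟` carry labels in `{ℓ, ℓ+1}` and neither `f \ g` nor `g \ f` is a member, then `f \ g = f ∩ (U \ g)` and
`U \ (g \ f) = f ∪ (U \ g)` are candidates of `f` (far products with `U \ g`). -/
theorem sdiff_mem_candidates_of_notMem (hU : ∀ a ∈ 𝒟, a ⊆ U) (hco : ∀ a ∈ 𝒟, U \ a ∈ 𝒟)
    (hanti : ∀ a ∈ 𝒟, x (U \ a) = x a + 3) {ℓ : ZMod 6} {f g : Finset α} (hf : f ∈ 𝒟) (hg : g ∈ 𝒟)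
    (hfl : x f = ℓ ∨ x f = ℓ + 1) (hgl : x g = ℓ ∨ x g = ℓ + 1) (h1 : f \ g ∉ 𝒟) (h2 : g \ f ∉ 𝒟) :
    f \ g ∈ candidates 𝒟 x f ∧ U \ (g \ f) ∈ candidates 𝒟 x f := by
  have hfar : ¬ Close (x f) (x (U \ g)) := by
    rw [hanti g hg]
    have key : ∀ i s t : ZMod 6, (s = i ∨ s = i + 1) → (t = i ∨ t = i + 1) → ¬ Close s (t + 3) := by decide
    exact key ℓ _ _ hfl hgl
  have e1 : f \ g = f ∩ (U \ g) := by
    have h := sdiff_univ_compl_eq_inter (U := U) (f := U \ g) (hU f hf)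
    rwa [Finset.sdiff_sdiff_eq_self (hU g hg)] at h
  have e2 : U \ (g \ f) = f ∪ (U \ g) := by
    ext i; simp only [mem_sdiff, mem_union]
    have h1 : i ∈ f → i ∈ U := fun h => hU f hf h
    grind
  have h2' : U \ (g \ f) ∉ 𝒟 := fun h => h2 (by
    have h' := hco _ h
    rwa [Finset.sdiff_sdiff_eq_self (sdiff_subset.trans (hU g hg))] at h')
  unfold candidates
  exact ⟨mem_sdiff.mpr ⟨mem_farProducts.mpr ⟨U \ g, hco g hg, hfar, Or.inl e1⟩, h1⟩,
    mem_sdiff.mpr ⟨mem_farProducts.mpr ⟨U \ g, hco g hg, hfar, Or.inr e2⟩, h2'⟩⟩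

/-- **For an MS-tight two-class dead family `F`, all of `ΔF ∪ co ΔF` are candidates of `cl F`** (no blockers: gen 69's
`not_blocked_of_twistedProduct`, the twisted-product structure coming from the pivot). -/
theorem cl_diffs_subset_biUnion_candidates_of_tight (hU : ∀ a ∈ 𝒟, a ⊆ U) (hco : ∀ a ∈ 𝒟, U \ a ∈ 𝒟)
    (hanti : ∀ a ∈ 𝒟, x (U \ a) = x a + 3) {F : Finset (Finset α)} (hF : F ⊆ dead U 𝒟 x) {ℓ : ZMod 6}
    (hlab : ∀ f ∈ F, x f = ℓ ∨ x f = ℓ + 1) (ht : #(F \\ F) = #F) :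
    (F \\ F) ∪ (F \\ F).image (fun z => U \ z) ⊆ (F ∪ F.image fun f => U \ f).biUnion (candidates 𝒟 x) := by
  rcases F.eq_empty_or_nonempty with rfl | hne
  · simp
  have hFD : ∀ f ∈ F, f ∈ 𝒟 := fun f hf => (mem_filter.mp (hF hf)).1
  obtain ⟨c, _, hpiv⟩ := TwistedAD.exists_pivot_of_card_diffs_eq_card F ht hne
  have hFeq : F = ((F.image (c \ ·)) ×ˢ (F.image (· \ c))).image (fun e => ∅ ∪ (c \ e.1) ∪ e.2) := by
    rw [show (fun e : Finset α × Finset α => ∅ ∪ (c \ e.1) ∪ e.2) = (fun e => (c \ e.1) ∪ e.2) from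
      funext fun e => by rw [empty_union]]
    exact eq_twistedProduct_of_pivot ht.le hpiv
  have hd₁I : ∀ d ∈ F.image (c \ ·), d ⊆ c := by
    intro d hd; obtain ⟨g, _, rfl⟩ := mem_image.mp hd; exact sdiff_subset
  have hd₂ : ∀ d ∈ F.image (· \ c), Disjoint d (∅ ∪ c) := by
    intro d hd; obtain ⟨g, _, rfl⟩ := mem_image.mp hd; rw [empty_union]; exact disjoint_sdiff_self_left
  -- no difference of two members of `F` is a member
  have hnd : ∀ f ∈ F, ∀ g ∈ F, f \ g ∉ 𝒟 := by
    intro f hf g hg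
    have key : ∀ i s t : ZMod 6, (s = i ∨ s = i + 1) → (t = i ∨ t = i + 1) → s = t ∨ t = s + 1 ∨ s = t + 1 := by decide
    rcases key ℓ _ _ (hlab f hf) (hlab g hg) with h | h | h
    · exact (sdiff_notMem_of_dead_of_label_eq hU hco hanti (hFD f hf) (hFD g hg) (mem_filter.mp (hF hf)).2
        (mem_filter.mp (hF hg)).2 h).2
    · have hb := not_blocked_of_twistedProduct hU hco hanti hd₁I hd₂ (diffClosed_image_sdiff_left ht.le hpiv)
        (diffClosed_image_sdiff_right ht.le hpiv) (by rw [← hFeq]; exact hF) (by rw [← hFeq]; exact hlab)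
        (by rw [← hFeq]; exact hf) (by rw [← hFeq]; exact hg) h
      exact hb.1
    · have hb := not_blocked_of_twistedProduct hU hco hanti hd₁I hd₂ (diffClosed_image_sdiff_left ht.le hpiv)
        (diffClosed_image_sdiff_right ht.le hpiv) (by rw [← hFeq]; exact hF) (by rw [← hFeq]; exact hlab)
        (by rw [← hFeq]; exact hg) (by rw [← hFeq]; exact hf) h
      exact hb.2
  intro e he
  rw [mem_union, mem_image] at he
  rcases he with he | ⟨e', he', rfl⟩
  · obtain ⟨f, hf, g, hg, rfl⟩ := Finset.mem_diffs.mp he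
    exact mem_biUnion.mpr ⟨f, mem_union_left _ hf, (sdiff_mem_candidates_of_notMem hU hco hanti (hFD f hf) (hFD g hg)
      (hlab f hf) (hlab g hg) (hnd f hf g hg) (hnd g hg f hf)).1⟩
  · obtain ⟨g, hg, f, hf, rfl⟩ := Finset.mem_diffs.mp he'
    exact mem_biUnion.mpr ⟨f, mem_union_left _ hf, (sdiff_mem_candidates_of_notMem hU hco hanti (hFD f hf) (hFD g hg)
      (hlab f hf) (hlab g hg) (hnd f hf g hg) (hnd g hg f hf)).2⟩

/-- **Hall's condition for `cl(F ∪ {q})` when the two-class dead family `F` is MS-tight** and `q ∉ F` is dead with `x q = ℓ + 1`: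
`2 #F + 2 ≤ #N(cl(F ∪ {q}))`.  (The tight case `F ∪ {q}` MS-tight is gen 69's; here `F ∪ {q}` itself need not be tight.) -/
theorem two_mul_card_add_two_le_card_biUnion_candidates_of_tight_insert (hU : ∀ a ∈ 𝒟, a ⊆ U) (hco : ∀ a ∈ 𝒟, U \ a ∈ 𝒟)
    (hanti : ∀ a ∈ 𝒟, x (U \ a) = x a + 3) {F : Finset (Finset α)} (hF : F ⊆ dead U 𝒟 x) {ℓ : ZMod 6}
    (hlab : ∀ f ∈ F, x f = ℓ ∨ x f = ℓ + 1) (ht : #(F \\ F) = #F) {q : Finset α} (hq : q ∈ dead U 𝒟 x)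
    (hqlab : x q = ℓ + 1) (hqF : q ∉ F) :
    2 * #F + 2 ≤ #((insert q F ∪ (insert q F).image fun f => U \ f).biUnion (candidates 𝒟 x)) := by
  classical
  have hFD : ∀ f ∈ F, f ∈ 𝒟 := fun f hf => (mem_filter.mp (hF hf)).1
  have hFU : ∀ f ∈ F, f ⊆ U := fun f hf => hU f (hFD f hf)
  have hqD : q ∈ 𝒟 := (mem_filter.mp hq).1
  have hcc : ∀ a : Finset α, a ⊆ U → U \ (U \ a) = a := fun a ha => Finset.sdiff_sdiff_eq_self ha
  set A := insert q F ∪ (insert q F).image fun f => U \ f with hA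
  set N := A.biUnion (candidates 𝒟 x) with hN
  set X := (F \\ F) ∪ (F \\ F).image (fun z => U \ z) with hX
  have hmono : (F ∪ F.image fun f => U \ f) ⊆ A :=
    union_subset_union (subset_insert q F) (image_subset_image (subset_insert q F))
  have hXN : X ⊆ N :=
    (cl_diffs_subset_biUnion_candidates_of_tight hU hco hanti hF hlab ht).trans (biUnion_subset_biUnion_of_subset_left _ hmono)
  have hint : ∀ f ∈ F, ∀ g ∈ F, (f ∩ g).Nonempty := fun f hf g hg =>
    inter_nonempty_of_dead_of_close (hF hf) (hFD g hg) (close_of_mem_pair (hlab f hf) (hlab g hg))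
  have hXcard : #X = 2 * #(F \\ F) := card_cl_diffs_eq_two_mul hFU hint
  rcases F.eq_empty_or_nonempty with hF0 | hFne
  · -- `F = ∅`: the candidates `∅`, `U` of `q`
    have h0 : (∅ : Finset α) ∉ 𝒟 := empty_notMem_of_dead hU hco hanti hq
    have hUn : U ∉ 𝒟 := fun h => h0 (by have := hco U h; rwa [Finset.sdiff_self] at this)
    have kfar : ∀ s : ZMod 6, ¬ Close s (s + 3) := by decide
    have hfar : ¬ Close (x q) (x (U \ q)) := by rw [hanti q hqD]; exact kfar _
    have hqA : q ∈ A := mem_union_left _ (mem_insert_self q F)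
    have h1 : ∅ ∈ N := mem_biUnion.mpr ⟨q, hqA, by
      unfold candidates
      exact mem_sdiff.mpr ⟨mem_farProducts.mpr ⟨U \ q, hco q hqD, hfar, Or.inl (inter_sdiff_self q U).symm⟩, h0⟩⟩
    have h2 : U \ ∅ ∈ N := mem_biUnion.mpr ⟨q, hqA, by
      rw [sdiff_empty]; unfold candidates
      exact mem_sdiff.mpr ⟨mem_farProducts.mpr ⟨U \ q, hco q hqD, hfar, Or.inr (by rw [union_sdiff_of_subset (hU q hqD)])⟩, hUn⟩⟩
    have h := card_add_two_le_card_of_pair (empty_subset N) h1 h2 (notMem_empty _) (notMem_empty _) (ne_compl_of_dead hU hq ∅)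
    rw [hF0, card_empty]; rw [card_empty] at h; omega
  · obtain ⟨c, hcF, hpiv⟩ := TwistedAD.exists_pivot_of_card_diffs_eq_card F ht hFne
    have htp := tp_mem_of_pivot ht.le hpiv
    have hsplit : ∀ e ∈ F \\ F, e ∩ c ∈ F.image (c \ ·) ∧ e \ c ∈ F.image (· \ c) :=
      fun e he => mem_diffs_pivot_split ht.le hpiv he
    obtain ⟨w, hw, hw1, hw2⟩ := exists_candidate_notMem_cl_diffs hU hco hanti hF hlab hq hqlab hqF hcF htp hsplit
    have hcD : c ∈ 𝒟 := hFD c hcF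
    have hqA : q ∈ A := mem_union_left _ (mem_insert_self q F)
    have hcA : c ∈ A := mem_union_left _ (mem_insert_of_mem hcF)
    have hcoA : ∀ s ∈ insert q F, U \ s ∈ A := fun s hs => mem_union_right _ (mem_image_of_mem _ hs)
    have hwN : w ∈ N ∧ U \ w ∈ N ∧ w ⊆ U := by
      rcases hw with hw | hw
      · refine ⟨mem_biUnion.mpr ⟨q, hqA, hw⟩, mem_biUnion.mpr ⟨U \ q, hcoA q (mem_insert_self q F), ?_⟩,
          candidates_subset_ground hU hqD hw⟩
        rw [candidates_compl hU hco hanti hqD]; exact mem_image_of_mem _ hw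
      · refine ⟨mem_biUnion.mpr ⟨c, hcA, hw⟩, mem_biUnion.mpr ⟨U \ c, hcoA c (mem_insert_of_mem hcF), ?_⟩,
          candidates_subset_ground hU hcD hw⟩
        rw [candidates_compl hU hco hanti hcD]; exact mem_image_of_mem _ hw
    obtain ⟨hwN1, hwN2, hwU⟩ := hwN
    have hXU : ∀ e ∈ F \\ F, e ⊆ U := by
      intro e he; obtain ⟨f, hf, g, _, rfl⟩ := Finset.mem_diffs.mp he; exact sdiff_subset.trans (hFU f hf)
    have hcw : U \ w ∉ X := by
      intro h
      rw [hX, mem_union, mem_image] at h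
      rcases h with h | ⟨e, he, hee⟩
      · exact hw2 (mem_image.mpr ⟨U \ w, h, hcc w hwU⟩)
      · apply hw1
        have : e = w := by
          have h1 := congrArg (fun t => U \ t) hee
          simp only [hcc e (hXU e he), hcc w hwU] at h1
          exact h1
        rw [← this]; exact he
    have hwX : w ∉ X := fun h => by rw [hX, mem_union] at h; exact h.elim hw1 hw2
    have h1 := card_add_two_le_card_of_pair hXN hwN1 hwN2 hwX hcw (ne_compl_of_dead hU hq w)
    rw [hXcard, ht] at h1
    exact h1

/-- Hall's inequality `#A ≤ #N(A)` for `A = cl(F ∪ {q})`, `F` an MS-tight two-class dead family, `q ∉ F` dead of the upper label. -/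
theorem card_le_card_biUnion_candidates_of_tight_insert (hU : ∀ a ∈ 𝒟, a ⊆ U) (hco : ∀ a ∈ 𝒟, U \ a ∈ 𝒟)
    (hanti : ∀ a ∈ 𝒟, x (U \ a) = x a + 3) {F : Finset (Finset α)} (hF : F ⊆ dead U 𝒟 x) {ℓ : ZMod 6}
    (hlab : ∀ f ∈ F, x f = ℓ ∨ x f = ℓ + 1) (ht : #(F \\ F) = #F) {q : Finset α} (hq : q ∈ dead U 𝒟 x)
    (hqlab : x q = ℓ + 1) (hqF : q ∉ F) :
    #(insert q F ∪ (insert q F).image fun f => U \ f) ≤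
      #((insert q F ∪ (insert q F).image fun f => U \ f).biUnion (candidates 𝒟 x)) := by
  refine le_trans ?_ (two_mul_card_add_two_le_card_biUnion_candidates_of_tight_insert hU hco hanti hF hlab ht hq hqlab hqF)
  refine (card_union_le _ _).trans ?_
  have h1 := card_insert_le q F
  have h2 : #((insert q F).image fun f => U \ f) ≤ #(insert q F) := card_image_le
  omega

/-- The same with the new member of the LOWER label `ℓ` (`F` two-class MS-tight with labels in `{ℓ, ℓ+1}`), by the reflection `x ↦ -x`. -/
theorem card_le_card_biUnion_candidates_of_tight_insert' (hU : ∀ a ∈ 𝒟, a ⊆ U) (hco : ∀ a ∈ 𝒟, U \ a ∈ 𝒟)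
    (hanti : ∀ a ∈ 𝒟, x (U \ a) = x a + 3) {F : Finset (Finset α)} (hF : F ⊆ dead U 𝒟 x) {ℓ : ZMod 6}
    (hlab : ∀ f ∈ F, x f = ℓ ∨ x f = ℓ + 1) (ht : #(F \\ F) = #F) {p : Finset α} (hp : p ∈ dead U 𝒟 x)
    (hplab : x p = ℓ) (hpF : p ∉ F) :
    #(insert p F ∪ (insert p F).image fun f => U \ f) ≤
      #((insert p F ∪ (insert p F).image fun f => U \ f).biUnion (candidates 𝒟 x)) := by
  have hanti' : ∀ a ∈ 𝒟, (fun s => -x s) (U \ a) = (fun s => -x s) a + 3 := by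
    intro a ha; show -x (U \ a) = -x a + 3; rw [hanti a ha]; exact neg_add_three (x a)
  have h := card_le_card_biUnion_candidates_of_tight_insert (x := fun s => -x s) hU hco hanti' (ℓ := -ℓ - 1)
    (F := F) (by rw [dead_neg]; exact hF) (fun f hf => by
      rcases hlab f hf with h | h
      · right; simp only [h]; ring
      · left; simp only [h]; ring) ht (q := p) (by rw [dead_neg]; exact hp) (by simp only [hplab]; ring) hpF
  rwa [candidates_neg] at h

end TightInsert

end GeneratedDonors

end Summit.CriticalPhenomena.PercolationContinuityZ3.Theorems
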